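/-
Copyright (c) 2026 the pub-hodgecm-mathlib formalisation cell (harness21).  Prover seat hodgecm-mathlib-K2E3-p23 (g7) (L1 VALVE DEAL, LEAD F0P6-plan (g14) BATCH #85
(1), line lead K2E5-p16 (g8) CENSUS MEMO 7c6ffe7718f089b5 §3 (K1a-1)), Track B «K2-LIT» ∕ hLiu418 #41 KIND 1 a♮, organ (K1a-GK) «the X₀₁-plane step», brick (K1a-1)
«corner index transport» (sequel of ★ p861405 `K2LiuRankOneBigCellCornerFrame`, ★ p861293 `K2LiuRankOneCornerOrbit`, ★ `K2LiuSiegelLeviConjUnipDeltaChar`).  THEOREMS ONLY.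
-/
import Summits.HodgeConjecture.HodgeConjecture.Theorems.K2LiuRankOneBigCellCornerFrame      -- ★ p861405 §1 `whittakerDelta_eq_integral_levi_conj` (+ ★ p861293 `corner_levi_iff_mk_eq`, ★ `K2LiuSiegelLeviConjUnipDeltaChar` §3, ★ `K2LiuSiegelRationalLeviDecomposition`)
import HarnessLib

/-!
# Crux `HLiu418`, #41 KIND 1 a♮ ∕ (K1a-GK), brick (K1a-1): TRANSPORT OF A RANK-ONE INDEX TO THE CORNER —
# `W_S(f)(h) = W_{S♭}(f)(Λĝ h)` with `S♭ = D₀ S g⁻¹ = σ♭ · E₁₁` («`ψ_{S♭}` pairs with `b₁₁` only»)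

Cell `hodgecm-mathlib`, crux item hLiu418 = `stmt-HodgeConjecture-24832` (helper lane `--kind proof --supports stmt-HodgeConjecture-24832 --as helper`, count-neutral);
squad K2 ∕ K2Liu, LEAD F0P6-plan (g14), line lead (K1a-GK) K2E5-p16 (g8), K1 desk F0P2-p11 (g2); prover K2E3-p23 (g7).  THEOREMS ONLY (no `def`, no `instance`, no
notation, no named-fact hypothesis, no `sorry`); every input is ★.

WHY (memo 7c6ffe77 §2 ROAD B, §3 (K1a-1)).  The Euler road for the singular big-cell term `(s−½)·W_S(f_s)(h)` of a rank-one coefficient `S = u ⊗ w` applies ★ G1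
`whittakerDelta_eq_mul_tprod_euler` to the CORNER index `S♭`, not to `S`: one first moves `S` to the corner by the rational Levi element `Λĝ`, `ĝ = γ[w]` (★ p861293).  ★ p861405
§1 already performs the measure-preserving change of variables `u = Λĝ⁻¹ v Λĝ` INSIDE the integral; this file closes the bookkeeping: the transported twist IS the character of
the transported index (★ `unipDeltaChar_conj_eq`: `ψ_S(p⁻¹ v p) = ψ_{D₀ S A₀⁻¹}(v)` for the rational Levi blocks `(A₀, D₀)` of `p`), so the right-hand side is again a
`whittakerDelta` — at the index `S♭ := D₀ S A₀⁻¹` and the translate `Λĝ h` — and for `ĝ = γ[w]` the index `S♭` is the corner entry `σ♭ E₁₁` (★ `corner_levi_iff_mk_eq`).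
* §1 (any `n`) `unipDeltaChar_single` — the CORNER LAW: `ψ_{σ E_{ij}}(v) = 𝐞(σ · X(v)_{ji})` (★ `unipDeltaChar_apply`, `Matrix.trace_single_mul`);
  **`whittakerDelta_eq_whittakerDelta_conj_index`** — for a Siegel section `f`, `g ∈ GL_n(L)`, the `Λĝ`-conjugation preserving `νN` BY VALUE (★ p861405's `hconj`
  verbatim) and rational Levi blocks `(A₀, D₀)` of `Λĝ` BY VALUE (★ `unipDeltaChar_conj_eq`'s `hA₀ ha hd` verbatim): `W_S(f)(h) = W_{D₀ S A₀⁻¹}(f)(Λĝ · h)` for EVERY `S`, `h`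
  (no convergence hypothesis); **`exists_rat_levi_blocks_levi_map`** — the blocks of `Λĝ` exist with `A₀ = g` (★ `exists_rat_levi_blocks`, ★ `deltaBlock_levi_apply`):
  `∃ D₀`, frame block `= D₀`, Levi relation `c(g)ᵀ T_L D₀ = T_L`, `det D₀` a unit.
* §2 (`n = 2`, rank one) **`conj_index_eq_single`** — for `S = u ⊗ w` `T_L`-skew (`u, w ≠ 0`), row section `γ`, `g = γ[w]` and its block `D₀`: `D₀ S g⁻¹ = σ♭ E₁₁` with
  `σ♭ := (D₀ S g⁻¹)₁₁ ≠ 0` (★ `corner_levi_iff_mk_eq … .2 (hγ [w]).symm`, descended to `L` along the injective `L → 𝔸_L`; `σ♭ ≠ 0` because `S ≠ 0` and `D₀, g` are invertible);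
  the HEAD **`exists_corner_index_whittakerDelta_eq`**: `∃ D₀ σ♭, σ♭ ≠ 0 ∧ (blocks of Λĝ) ∧ D₀ S g⁻¹ = σ♭ E₁₁ ∧ ∀ h, W_S(f)(h) = W_{σ♭ E₁₁}(f)(Λĝ h)` — the input of (K1a-4)
  (★ G1 at the corner index) and of (K1a-2) (the local corner character `𝐞(σ♭ x)`).
NOT HERE (honest): the identification of `σ♭` with the (o1) constructor's letter `val S` up to `v`-units (seam (σ) of the memo: `ord_v σ♭ = ord_v (val S)` off `T`) —
`val` is a binder of ★ p862379, not a tree definition; (K1a-2)∕(K1a-4) read `σ♭` directly from this file.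
References: [MoeglinWaldspurger1995] II.1.7; [KudlaRallis1994] §2 (2.10)–(2.12); [Shimura1997] §18.3–18.5; [HarrisKudlaSweet1996] §1 (1.11)–(1.12); [Tan1999] §4.
HONEST LABEL.  Count-neutral helper (pure transport, pays no socket): `HC_CM` is proved only modulo the 7 printed citations (2 remaining named inputs: hLiu418 =
`stmt-HodgeConjecture-24832`, h413 = `stmt-HodgeConjecture-24833`) until rung 0 closes.
-/

set_option autoImplicit false
set_option linter.dupNamespace false -- the mandated namespace repeats `HodgeConjecture.HodgeConjecture`

noncomputable section

open scoped Matrix ENNReal NNReal ComplexConjugate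
open NumberField IsDedekindDomain MeasureTheory MeasureTheory.Measure Filter Set Function
open Literature.NumberTheory.Automorphic Literature.NumberTheory.Automorphic.UnitaryGroup Literature.NumberTheory.GaloisRepresentations
open Literature.NumberTheory.GelbartRogawski1991 Literature.NumberTheory.GelbartRogawski1991.GRConstruction
open Literature.NumberTheory.GelbartRogawski1991.AdaptedBlocks
open Literature.NumberTheory.K2Lit.SiegelDoubled Literature.MeasureTheory.Group
open UnitaryDualPair

namespace Summit.HodgeConjecture.HodgeConjecture.Cruxes.HLiu418.K2LiuRankOneCornerIndexTransport

open K2LiuUnipotentCoveringWeight K2LiuSiegelUnipotentFourierDefs K2LiuSiegelUnipotentCharacters K2LiuSiegelLeviConjUnipDeltaChar K2LiuSiegelRationalLeviDecomposition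
  K2LiuSiegelDoubledRationalPoints K2LiuSiegelMiddleCellLeviCriterion K2LiuConstantTermMiddleCellPrelims K2LiuSiegelWeylCharacterLaw K2LiuWeylDeltaRational
  K2LiuSiegelCharacterTrivialOnRational K2LiuRankOneOrbitTransport K2LiuRankOneCornerOrbit K2LiuRankOneBigCellUnfold K2LiuRankOneBigCellCornerFrame

variable {L : Type} [Field L] [NumberField L] [IsCMField L]

/-! ## §1 Any rank `n`: the corner law and the transport of the index under a rational Levi element -/

section AnyRank

variable {N M n : ℕ} {e : Fin N × Fin M ≃ Fin n}
  {dV : Fin N → L} {hdV : ∀ i, IsCMField.complexConj L (dV i) = dV i}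
  {dW : Fin M → L} {hdW : ∀ i, IsCMField.complexConj L (dW i) = dW i}

/-- `(σ E_{ij})` mapped along a ring hom is `(f σ) E_{ij}`. [folklore] -/
private theorem single_map {R R' : Type*} [Semiring R] [Semiring R'] (f : R →+* R') (i j : Fin n) (σ : R) :
    (Matrix.single i j σ).map f = Matrix.single i j (f σ) := by
  ext i' j'
  rw [Matrix.map_apply]
  by_cases h : i = i' ∧ j = j'
  · obtain ⟨rfl, rfl⟩ := h
    rw [Matrix.single_apply_same, Matrix.single_apply_same]
  · simp only [Matrix.single, Matrix.of_apply, if_neg h, map_zero]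

/-- **THE CORNER LAW**: the character of the single-entry index `σ E_{ij}` reads ONE coordinate of `X(v)`: `ψ_{σ E_{ij}}(v) = 𝐞(σ · X(v)_{ji})`
(`tr(σ E_{ij} X) = σ X_{ji}`; ★ `unipDeltaChar_apply`).  For `i = j = 1` (`n = 2`): «`ψ_{S♭}` pairs with `b₁₁` only». [cite: Shimura1997, §18.3] [cite: MoeglinWaldspurger1995, II.1.7] -/
theorem unipDeltaChar_single (i j : Fin n) (σ : L) (v : HA L e dV hdV dW hdW) :
    unipDeltaChar L e dV hdV dW hdW (Matrix.single i j σ) v =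
      adeleAddChar L (algebraMap L (AdeleRing (𝓞 L) L) σ * (blk L e dV hdV dW hdW v).toBlocks₁₂ j i) := by
  rw [unipDeltaChar_apply, single_map, Matrix.trace_single_mul, smul_eq_mul]

variable [MeasurableSpace (unipDelta L e dV hdV dW hdW)] [BorelSpace (unipDelta L e dV hdV dW hdW)]
  (Λ : GL (Fin n) (AdeleRing (𝓞 L) L) →* HA L e dV hdV dW hdW)
  (hΛ : ∀ g : GL (Fin n) (AdeleRing (𝓞 L) L), blk L e dV hdV dW hdW (Λ g) =
    cayR (AdeleRing (𝓞 L) L) (Fin n) * Matrix.fromBlocks (g : Matrix (Fin n) (Fin n) (AdeleRing (𝓞 L) L)) 0 0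
      (((gramR L e dV hdV dW hdW).map ((algebraMap L (AdeleRing (𝓞 L) L)).comp (algebraMap (Fp L) L)))⁻¹ *
        (((g⁻¹ : GL (Fin n) (AdeleRing (𝓞 L) L)) : Matrix (Fin n) (Fin n) (AdeleRing (𝓞 L) L)).map
          (conjAdele (Fp L) L (IsCMField.complexConj L)))ᵀ *
        (gramR L e dV hdV dW hdW).map ((algebraMap L (AdeleRing (𝓞 L) L)).comp (algebraMap (Fp L) L))) *
      cayRinv (AdeleRing (𝓞 L) L) (Fin n))

include hΛ in
/-- **TRANSPORT OF THE INDEX UNDER A RATIONAL LEVI ELEMENT.**  For a Siegel section `f` of `I_Δ(s, χ)`, `g ∈ GL_n(L)` with `u ↦ Λĝ u Λĝ⁻¹` preserving `νN` (BY VALUE, ★ p861405's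
`hconj`), rational Levi blocks `(A₀, D₀)` of `Λĝ` (BY VALUE, as ★ `unipDeltaChar_conj_eq`: `deltaBlock Λĝ = A₀`, frame block `= D₀`), any index `S` and `h ∈ H(𝔸)`:
`W_S(f)(h) = W_{D₀ S A₀⁻¹}(f)(Λĝ · h)` — ★ p861405 §1 (change of variables) + ★ `unipDeltaChar_conj_eq` under the integral; no convergence hypothesis (both sides are the same
Bochner integral). [cite: MoeglinWaldspurger1995, II.1.7] [cite: KudlaRallis1994, §2 (2.10)–(2.12)] [cite: HarrisKudlaSweet1996, §1 (1.12)] -/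
theorem whittakerDelta_eq_whittakerDelta_conj_index (hdV0 : ∀ i, dV i ≠ 0) (hdW0 : ∀ i, dW i ≠ 0) (νN : Measure (unipDelta L e dV hdV dW hdW)) [νN.IsMulLeftInvariant]
    {χ : HeckeCharacter L} {s : ℂ} {f : HA L e dV hdV dW hdW → ℂ} (hf : IsSiegelDeltaSection L e dV hdV dW hdW χ s f) (g : GL (Fin n) L)
    (hconj : MeasurePreserving (fun u : unipDelta L e dV hdV dW hdW =>
      (⟨Λ (Matrix.GeneralLinearGroup.map (algebraMap L (AdeleRing (𝓞 L) L)) g) * (u : HA L e dV hdV dW hdW) *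
          (Λ (Matrix.GeneralLinearGroup.map (algebraMap L (AdeleRing (𝓞 L) L)) g))⁻¹,
        conj_levi_mem_unipDelta L e dV hdV dW hdW Λ hΛ _ u.2⟩ : unipDelta L e dV hdV dW hdW)) νN νN)
    {A₀ D₀ : Matrix (Fin n) (Fin n) L} (hA₀ : IsUnit A₀.det)
    (ha : deltaBlock L e dV hdV dW hdW (Λ (Matrix.GeneralLinearGroup.map (algebraMap L (AdeleRing (𝓞 L) L)) g)) = A₀.map (algebraMap L (AdeleRing (𝓞 L) L)))
    (hd : (Matrix.fromBlocks (1 : Matrix (Fin n) (Fin n) (AdeleRing (𝓞 L) L)) 0 (-1) 1 *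
        blk L e dV hdV dW hdW (Λ (Matrix.GeneralLinearGroup.map (algebraMap L (AdeleRing (𝓞 L) L)) g)) * Matrix.fromBlocks 1 0 1 1).toBlocks₂₂ =
      D₀.map (algebraMap L (AdeleRing (𝓞 L) L)))
    (S : Matrix (Fin n) (Fin n) L) (h : HA L e dV hdV dW hdW) :
    whittakerDelta L e dV hdV dW hdW νN S f h =
      whittakerDelta L e dV hdV dW hdW νN (D₀ * S * A₀⁻¹) f (Λ (Matrix.GeneralLinearGroup.map (algebraMap L (AdeleRing (𝓞 L) L)) g) * h) := by
  rw [whittakerDelta_eq_integral_levi_conj Λ hΛ hdV0 hdW0 νN hf g hconj S h, whittakerDelta_def]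
  refine integral_congr_ae (ae_of_all _ fun v => ?_)
  dsimp only
  rw [unipDeltaChar_conj_eq L e dV hdV dW hdW (isSiegelDelta_levi_apply L e dV hdV dW hdW Λ hΛ _) hA₀ ha hd S v.2]

omit [MeasurableSpace (unipDelta L e dV hdV dW hdW)] [BorelSpace (unipDelta L e dV hdV dW hdW)] in
include hΛ in
/-- **THE RATIONAL LEVI BLOCKS OF `Λĝ`, `g ∈ GL_n(L)`**: `deltaBlock Λĝ = g` (★ `deltaBlock_levi_apply`) and there is `D₀ ∈ M_n(L)` with frame block `D₀`, the Levi relation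
`c(g)ᵀ · T_L · D₀ = T_L`, and `det D₀` a unit (★ `exists_rat_levi_blocks` on ★ `isSiegelDelta_levi_apply`, ★ `levi_map_mem_ratH`; `A₀ = g` by injectivity of `L → 𝔸_L`).
[cite: HarrisKudlaSweet1996, §1 (1.11)] -/
theorem exists_rat_levi_blocks_levi_map (hdV0 : ∀ i, dV i ≠ 0) (hdW0 : ∀ i, dW i ≠ 0) (g : GL (Fin n) L) :
    deltaBlock L e dV hdV dW hdW (Λ (Matrix.GeneralLinearGroup.map (algebraMap L (AdeleRing (𝓞 L) L)) g)) =
        (g : Matrix (Fin n) (Fin n) L).map (algebraMap L (AdeleRing (𝓞 L) L)) ∧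
      ∃ D₀ : Matrix (Fin n) (Fin n) L,
        (Matrix.fromBlocks (1 : Matrix (Fin n) (Fin n) (AdeleRing (𝓞 L) L)) 0 (-1) 1 *
            blk L e dV hdV dW hdW (Λ (Matrix.GeneralLinearGroup.map (algebraMap L (AdeleRing (𝓞 L) L)) g)) * Matrix.fromBlocks 1 0 1 1).toBlocks₂₂ =
          D₀.map (algebraMap L (AdeleRing (𝓞 L) L)) ∧
        ((g : Matrix (Fin n) (Fin n) L).map ((IsCMField.complexConj L : L ≃ₐ[Fp L] L) : L →+* L))ᵀ * (gramR L e dV hdV dW hdW).map (algebraMap (Fp L) L) * D₀ =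
          (gramR L e dV hdV dW hdW).map (algebraMap (Fp L) L) ∧
        IsUnit D₀.det := by
  have ha : deltaBlock L e dV hdV dW hdW (Λ (Matrix.GeneralLinearGroup.map (algebraMap L (AdeleRing (𝓞 L) L)) g)) =
      (g : Matrix (Fin n) (Fin n) L).map (algebraMap L (AdeleRing (𝓞 L) L)) := by
    rw [deltaBlock_levi_apply L e dV hdV dW hdW Λ hΛ]; rfl
  refine ⟨ha, ?_⟩
  obtain ⟨A₀, D₀, hA₀, ha', hd, hrel⟩ := exists_rat_levi_blocks L e dV hdV dW hdW hdV0 hdW0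
    (isSiegelDelta_levi_apply L e dV hdV dW hdW Λ hΛ _) (levi_map_mem_ratH L e dV hdV dW hdW Λ hΛ hdV0 hdW0 g)
  have hinj : Function.Injective (fun A : Matrix (Fin n) (Fin n) L => A.map (algebraMap L (AdeleRing (𝓞 L) L))) :=
    fun A B hAB => Matrix.ext fun i j => AdeleRing.algebraMap_injective (𝓞 L) L (congrFun (congrFun hAB i) j)
  have hAg : A₀ = (g : Matrix (Fin n) (Fin n) L) := hinj (ha'.symm.trans ha)
  subst hAg
  obtain ⟨hT, -, -, -⟩ := gramRL_facts L e dV hdV dW hdW hdV0 hdW0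
  refine ⟨D₀, hd, hrel, ?_⟩
  have h1 := congrArg Matrix.det hrel
  rw [Matrix.det_mul, Matrix.det_mul] at h1
  exact isUnit_of_mul_isUnit_right (h1 ▸ hT)

end AnyRank

/-! ## §2 `n = 2`, rank one: the transported index is the corner entry `σ♭ E₁₁` -/

section Two

variable {N M : ℕ} {e : Fin N × Fin M ≃ Fin 2}
  {dV : Fin N → L} {hdV : ∀ i, IsCMField.complexConj L (dV i) = dV i}
  {dW : Fin M → L} {hdW : ∀ i, IsCMField.complexConj L (dW i) = dW i}
variable [MeasurableSpace (unipDelta L e dV hdV dW hdW)] [BorelSpace (unipDelta L e dV hdV dW hdW)]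
  (Λ : GL (Fin 2) (AdeleRing (𝓞 L) L) →* HA L e dV hdV dW hdW)
  (hΛ : ∀ g : GL (Fin 2) (AdeleRing (𝓞 L) L), blk L e dV hdV dW hdW (Λ g) =
    cayR (AdeleRing (𝓞 L) L) (Fin 2) * Matrix.fromBlocks (g : Matrix (Fin 2) (Fin 2) (AdeleRing (𝓞 L) L)) 0 0
      (((gramR L e dV hdV dW hdW).map ((algebraMap L (AdeleRing (𝓞 L) L)).comp (algebraMap (Fp L) L)))⁻¹ *
        (((g⁻¹ : GL (Fin 2) (AdeleRing (𝓞 L) L)) : Matrix (Fin 2) (Fin 2) (AdeleRing (𝓞 L) L)).map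
          (conjAdele (Fp L) L (IsCMField.complexConj L)))ᵀ *
        (gramR L e dV hdV dW hdW).map ((algebraMap L (AdeleRing (𝓞 L) L)).comp (algebraMap (Fp L) L))) *
      cayRinv (AdeleRing (𝓞 L) L) (Fin 2))

omit [MeasurableSpace (unipDelta L e dV hdV dW hdW)] [BorelSpace (unipDelta L e dV hdV dW hdW)] in
include hΛ in
/-- **THE TRANSPORTED RANK-ONE INDEX IS THE CORNER ENTRY.**  For a `T_L`-skew rank-one index `S = u ⊗ w` (`u, w ≠ 0`), a row section `γ` of `ℙ¹(L)`, `g = γ[w]`, and the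
frame block `D₀` of `Λĝ` (a unit): `D₀ S g⁻¹ = σ♭ E₁₁` with `σ♭ := (D₀ S g⁻¹)₁₁ ≠ 0`.  The corner support is ★ p861293 `corner_levi_iff_mk_eq` (⇐, at `[w] = [g₁]` by `hγ`),
read over `L` along the injective `L → 𝔸_L`; `σ♭ ≠ 0` since `S ≠ 0` and `D₀`, `g` are invertible. [cite: KudlaRallis1994, §2] [cite: Shimura1997, §18.3]
[cite: MoeglinWaldspurger1995, II.1.7] -/
theorem conj_index_eq_single (hdV0 : ∀ i, dV i ≠ 0) (hdW0 : ∀ i, dW i ≠ 0) {S : Matrix (Fin 2) (Fin 2) L}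
    (hS : S ∈ skewMatrices ((IsCMField.complexConj L : L ≃ₐ[Fp L] L) : L →+* L) ((gramR L e dV hdV dW hdW).map (algebraMap (Fp L) L)))
    {u w : Fin 2 → L} (hS1 : S = Matrix.vecMulVec u w) (hu : u ≠ 0) (hw : w ≠ 0)
    (γ : Projectivization L (Fin 2 → L) → GL (Fin 2) L)
    (hγ : ∀ p, Projectivization.mk L ((γ p : Matrix (Fin 2) (Fin 2) L) 1) (row_ne_zero (γ p) 1) = p)
    {D₀ : Matrix (Fin 2) (Fin 2) L}
    (hd : (Matrix.fromBlocks (1 : Matrix (Fin 2) (Fin 2) (AdeleRing (𝓞 L) L)) 0 (-1) 1 *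
        blk L e dV hdV dW hdW (Λ (Matrix.GeneralLinearGroup.map (algebraMap L (AdeleRing (𝓞 L) L)) (γ (Projectivization.mk L w hw)))) *
          Matrix.fromBlocks 1 0 1 1).toBlocks₂₂ = D₀.map (algebraMap L (AdeleRing (𝓞 L) L)))
    (hD₀ : IsUnit D₀.det) :
    D₀ * S * ((γ (Projectivization.mk L w hw) : GL (Fin 2) L) : Matrix (Fin 2) (Fin 2) L)⁻¹ =
        Matrix.single 1 1 ((D₀ * S * ((γ (Projectivization.mk L w hw) : GL (Fin 2) L) : Matrix (Fin 2) (Fin 2) L)⁻¹) 1 1) ∧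
      (D₀ * S * ((γ (Projectivization.mk L w hw) : GL (Fin 2) L) : Matrix (Fin 2) (Fin 2) L)⁻¹) 1 1 ≠ 0 := by
  set g : GL (Fin 2) L := γ (Projectivization.mk L w hw) with hgdef
  set f := algebraMap L (AdeleRing (𝓞 L) L) with hf
  have hcorner := (corner_levi_iff_mk_eq L e dV hdV dW hdW Λ hΛ hdV0 hdW0 hS hS1 hu hw g).2 (hγ (Projectivization.mk L w hw)).symm
  have hgdet : IsUnit (g : Matrix (Fin 2) (Fin 2) L).det := Matrix.isUnits_det_units g
  have ha : deltaBlock L e dV hdV dW hdW (Λ (Matrix.GeneralLinearGroup.map f g)) = (g : Matrix (Fin 2) (Fin 2) L).map f := by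
    rw [deltaBlock_levi_apply L e dV hdV dW hdW Λ hΛ]; rfl
  have hinj : Function.Injective (fun A : Matrix (Fin 2) (Fin 2) L => A.map f) :=
    fun A B hAB => Matrix.ext fun i j => AdeleRing.algebraMap_injective (𝓞 L) L (congrFun (congrFun hAB i) j)
  -- descend the corner equation to `L`
  have hmap : (Matrix.fromBlocks (1 : Matrix (Fin 2) (Fin 2) (AdeleRing (𝓞 L) L)) 0 (-1) 1 *
          blk L e dV hdV dW hdW (Λ (Matrix.GeneralLinearGroup.map f g)) * Matrix.fromBlocks 1 0 1 1).toBlocks₂₂ *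
        S.map f * (deltaBlock L e dV hdV dW hdW (Λ (Matrix.GeneralLinearGroup.map f g)))⁻¹ =
      (D₀ * S * (g : Matrix (Fin 2) (Fin 2) L)⁻¹).map f := by
    rw [Matrix.map_mul, Matrix.map_mul, map_nonsing_inv_of_isUnit f hgdet, ← ha, ← hd]
  have hdiag : Matrix.diagonal (fun i => f ((![0, 1] : Fin 2 → L) i)) = (Matrix.diagonal (![0, 1] : Fin 2 → L)).map f := by
    rw [Matrix.diagonal_map (map_zero f)]
  rw [hmap, hdiag, ← Matrix.map_mul, ← Matrix.map_mul, hinj.eq_iff] at hcorner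
  set T := D₀ * S * (g : Matrix (Fin 2) (Fin 2) L)⁻¹ with hTdef
  -- entrywise: `T i j = χ i * T i j * χ j`, `χ = ![0, 1]`
  have hentry : ∀ i j : Fin 2, T i j = (![0, 1] : Fin 2 → L) i * T i j * (![0, 1] : Fin 2 → L) j := fun i j => by
    have hij := congrFun (congrFun hcorner i) j
    simpa only [Matrix.mul_diagonal, Matrix.diagonal_mul] using hij
  have hsingle : T = Matrix.single 1 1 (T 1 1) := by
    ext i j
    have hij := hentry i j
    fin_cases i <;> fin_cases j
    · simpa using hij
    · simpa using hij
    · simpa using hij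
    · simp
  refine ⟨hsingle, fun h0 => ?_⟩
  -- `σ♭ = 0` would force `S = D₀⁻¹ T g = 0`, but `S = u ⊗ w ≠ 0`
  have hT0 : T = 0 := by rw [hsingle, h0, Matrix.single_zero]
  have hS0 : S = 0 := by
    have h1 : D₀⁻¹ * T * (g : Matrix (Fin 2) (Fin 2) L) = S := by
      rw [hTdef, Matrix.mul_assoc D₀, Matrix.nonsing_inv_mul_cancel_left D₀ _ hD₀, Matrix.nonsing_inv_mul_cancel_right _ S hgdet]
    rw [← h1, hT0, Matrix.mul_zero, Matrix.zero_mul]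
  obtain ⟨i, hi⟩ := Function.ne_iff.1 hu
  obtain ⟨k, hk⟩ := Function.ne_iff.1 hw
  have hik := congrFun (congrFun hS0 i) k
  rw [hS1, Matrix.vecMulVec_apply, Matrix.zero_apply] at hik
  exact mul_ne_zero hi hk hik

include hΛ in
/-- **(K1a-1) HEAD — THE BIG CELL OF A RANK-ONE COEFFICIENT IS THE BIG CELL OF ITS CORNER INDEX AT THE TRANSLATE `Λĝ h`.**  For a Siegel section `f` of `I_Δ(s, χ)`, a
`T_L`-skew rank-one `S = u ⊗ w`, a row section `γ`, `g = γ[w]`, and the `Λĝ`-conjugation preserving `νN` BY VALUE: there are the frame block `D₀` of `Λĝ` (Levi relation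
`c(g)ᵀ T_L D₀ = T_L`) and `σ♭ ∈ L`, `σ♭ ≠ 0`, with `D₀ S g⁻¹ = σ♭ E₁₁` and, for EVERY `h ∈ H(𝔸)`,
`W_S(f)(h) = W_{σ♭ E₁₁}(f)(Λĝ · h)` — whose character pairs with `b₁₁` only (`unipDeltaChar_single`).  Inputs of ROAD B: ★ G1 at the corner index ((K1a-4)), the local
corner character `𝐞(σ♭ x)` ((K1a-2)). [cite: MoeglinWaldspurger1995, II.1.7] [cite: KudlaRallis1994, §2 (2.10)–(2.12)] [cite: Shimura1997, §18.4–18.5] [cite: Tan1999, §4] -/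
theorem exists_corner_index_whittakerDelta_eq (hdV0 : ∀ i, dV i ≠ 0) (hdW0 : ∀ i, dW i ≠ 0)
    (νN : Measure (unipDelta L e dV hdV dW hdW)) [νN.IsMulLeftInvariant]
    {χ : HeckeCharacter L} {s : ℂ} {f : HA L e dV hdV dW hdW → ℂ} (hf : IsSiegelDeltaSection L e dV hdV dW hdW χ s f)
    {S : Matrix (Fin 2) (Fin 2) L}
    (hS : S ∈ skewMatrices ((IsCMField.complexConj L : L ≃ₐ[Fp L] L) : L →+* L) ((gramR L e dV hdV dW hdW).map (algebraMap (Fp L) L)))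
    {u w : Fin 2 → L} (hS1 : S = Matrix.vecMulVec u w) (hu : u ≠ 0) (hw : w ≠ 0)
    (γ : Projectivization L (Fin 2 → L) → GL (Fin 2) L)
    (hγ : ∀ p, Projectivization.mk L ((γ p : Matrix (Fin 2) (Fin 2) L) 1) (row_ne_zero (γ p) 1) = p)
    (hconj : MeasurePreserving (fun v : unipDelta L e dV hdV dW hdW =>
      (⟨Λ (Matrix.GeneralLinearGroup.map (algebraMap L (AdeleRing (𝓞 L) L)) (γ (Projectivization.mk L w hw))) * (v : HA L e dV hdV dW hdW) *
          (Λ (Matrix.GeneralLinearGroup.map (algebraMap L (AdeleRing (𝓞 L) L)) (γ (Projectivization.mk L w hw))))⁻¹,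
        conj_levi_mem_unipDelta L e dV hdV dW hdW Λ hΛ _ v.2⟩ : unipDelta L e dV hdV dW hdW)) νN νN) :
    ∃ (D₀ : Matrix (Fin 2) (Fin 2) L) (σ : L), σ ≠ 0 ∧
      (Matrix.fromBlocks (1 : Matrix (Fin 2) (Fin 2) (AdeleRing (𝓞 L) L)) 0 (-1) 1 *
          blk L e dV hdV dW hdW (Λ (Matrix.GeneralLinearGroup.map (algebraMap L (AdeleRing (𝓞 L) L)) (γ (Projectivization.mk L w hw)))) *
            Matrix.fromBlocks 1 0 1 1).toBlocks₂₂ = D₀.map (algebraMap L (AdeleRing (𝓞 L) L)) ∧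
      (((γ (Projectivization.mk L w hw) : GL (Fin 2) L) : Matrix (Fin 2) (Fin 2) L).map ((IsCMField.complexConj L : L ≃ₐ[Fp L] L) : L →+* L))ᵀ *
          (gramR L e dV hdV dW hdW).map (algebraMap (Fp L) L) * D₀ = (gramR L e dV hdV dW hdW).map (algebraMap (Fp L) L) ∧
      D₀ * S * (((γ (Projectivization.mk L w hw) : GL (Fin 2) L) : Matrix (Fin 2) (Fin 2) L))⁻¹ = Matrix.single 1 1 σ ∧
      ∀ h : HA L e dV hdV dW hdW,
        whittakerDelta L e dV hdV dW hdW νN S f h =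
          whittakerDelta L e dV hdV dW hdW νN (Matrix.single 1 1 σ) f
            (Λ (Matrix.GeneralLinearGroup.map (algebraMap L (AdeleRing (𝓞 L) L)) (γ (Projectivization.mk L w hw))) * h) := by
  obtain ⟨ha, D₀, hd, hrel, hD₀⟩ := exists_rat_levi_blocks_levi_map Λ hΛ hdV0 hdW0 (γ (Projectivization.mk L w hw))
  obtain ⟨hsingle, hσ⟩ := conj_index_eq_single Λ hΛ hdV0 hdW0 hS hS1 hu hw γ hγ hd hD₀
  refine ⟨D₀, _, hσ, hd, hrel, hsingle, fun h => ?_⟩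
  rw [← hsingle]
  exact whittakerDelta_eq_whittakerDelta_conj_index Λ hΛ hdV0 hdW0 νN hf (γ (Projectivization.mk L w hw)) hconj
    (Matrix.isUnits_det_units _) ha hd S h

end Two

end Summit.HodgeConjecture.HodgeConjecture.Cruxes.HLiu418.K2LiuRankOneCornerIndexTransport

end
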